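import Summits.BirchSwinnertonDyer.BirchSwinnertonDyer.Theorems.Rank1ResidualJetCarrierEndFormsNoCV
import Summits.BirchSwinnertonDyer.Rank1Residual.JET.McCallumProp44ByName
import HarnessLib

/-!
# T1 JET (cell `bsd-jet`), road K — the END FORMS with EVERY input a named Literature statement and
# NO reading binder: K3 ∕ K1 ∕ K4 ⟸ {[McC] Prop. 5.2, Poitou–Tate for Selmer structures,
# F1 = [GZ86 III (3.1)] ∕ Gross 1991 §6, (γ) = Gross 1991 Prop. 3.7 (2) image-free}

HONEST FRAMING (programme file `BSD-LIT2PART-PROGRAMME-v1.md` §HONESTY, verbatim): «no tranche here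
proves BSD; ARM L moves the LITERAL column of an r ≤ 1 census into the kernel-proved-modulo-named-print
column; ARM P changes what «named print» is worth.» THEOREMS ONLY (seat `bsd-jet-pv-1`, session g8;
`--supports stmt-BirchSwinnertonDyer-14418`, helper); nothing is booked, no flag is struck by this
file, 0 classes move (road K is DOCUMENTARY); K1 ∕ K3 ∕ K4 stay `@[conjecture]`.

WHAT THIS FILE DOES. Three three-line compositions. The typer's END FORMS
`JET.jetchevDivisibilityCarrier{Mult,Ne,Add}_of_namedPrintGross37 h52 hCV hPT hF1 h372`
(`JET/McCallumProp44ByName.lean`, seat `bsd-jet-ty` g10) feed the closed binders `h44` and `hGZ` of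
pv-2's `…_of_namedPrintOnly` BY NAME — `h44 := JET.prop44_of_frobeniusCongruence h372` (Gross 1991
Prop. 3.7 (2), image-free, through cell bsd-stepL corner-p1's kernel body) and
`hGZ := JET.forall_hGZ_of_Gross1991 hF1` (the schema's own guards `p ≠ 2`, `ρ̄` onto give `¬CM`) — but
keep the reading binder K5 (`hCV : JET.JetchevCoreVertexExistence`). This seat's
`…_of_namedPrintNoCV h52 h44 hPT hGZ` (`Rank1ResidualJetCarrierEndFormsNoCV.lean`, p546144) has no K5
(Jetchev Prop. 5.3 at `p ∣ N` is the kernel theorem `jetchevCoreVertexExistence_lt_of_namedPrint`,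
p543972). Composing the two:
`jetchevDivisibilityCarrier{Mult,Ne,Add}_of_literatureNoCV : h52 → hPT → hF1 → h372 → K3 ∕ K1 ∕ K4`.
ROAD-K RESIDUAL AFTER THIS FILE, BY NAME — four Literature `def … : Prop` statements, all PUBLISHED,
nothing else: `McCallum1991.prop52_exists_conductor_kolyvaginClass_order_eq` ([McC] Prop. 5.2; seat
pv-2 g6 is striking it in the kernel), `poitouTate_selmerStructure_duality_conj` (Poitou–Tate for
Selmer structures, conjugation form), `Gross1991_heegnerPoint_sub_ratTorsion_mem_E0` (F1: [GZ86 III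
(3.1)] as Gross 1991 §6 uses it), `GrossLMS1991.prop37_2_frobeniusCongruence` ((γ), image-free).
No reading binder, no local print-to-type hypothesis, no kernel gap, no schema.
References: [cite: Jetchev2008, Thm. 1.4 (p. 812), Thm. 5.2, Prop. 4.9, Prop. 5.3, Proof of Thm. 1.1
(pp. 820–824)] [cite: McCallumLMS1991, §4 Prop. 4.4, §5 Prop. 5.2] [cite: GrossLMS1991, Prop. 3.7 (2),
§6 Prop. 6.2 (1)] [cite: GrossZagier1986, III (3.1)] [cite: MilneADT2006, Ch. I, Thm. 4.10(b)].
-/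

set_option autoImplicit false

noncomputable section

open scoped Classical

open WeierstrassCurve IsDedekindDomain NumberField Field Literature.NumberTheory.EllipticCurves
  Literature.NumberTheory.EllipticCurves.ModularForms Literature.NumberTheory.EllipticCurves.Jetchev2008
  Literature.NumberTheory.EllipticCurves.KolyvaginCocycle
  Literature.NumberTheory.GaloisRepresentations Literature.NumberTheory.GaloisCohomology
  Literature.NumberTheory.GaloisRepresentations.DiscreteGaloisModule
  Summit.BirchSwinnertonDyer.Rank1Residual.X11b Summit.BirchSwinnertonDyer.Rank1Residual.X11b.Three
  Summit.BirchSwinnertonDyer.Rank1Residual.JET.SelmerVocabulary Literature.NumberTheory.Automorphic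
  Summit.BirchSwinnertonDyer.BirchSwinnertonDyer.Theorems

namespace Summit.BirchSwinnertonDyer.Rank1Residual.JET

/-- **K3 ⟸ four named Literature statements, NO reading binder** (multiplicative carrier `p ∣ N`):
{[McC] Prop. 5.2, Poitou–Tate for Selmer structures, F1, (γ) Gross Prop. 3.7 (2) image-free}.
[cite: Jetchev2008, Thm. 1.4, Thm. 5.2, Prop. 4.9, Prop. 5.3] [cite: McCallumLMS1991, Prop. 4.4, Prop. 5.2]
[cite: GrossLMS1991, Prop. 3.7, §6] [cite: GrossZagier1986, III (3.1)] -/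
theorem jetchevDivisibilityCarrierMult_of_literatureNoCV
    (h52 : McCallum1991.prop52_exists_conductor_kolyvaginClass_order_eq)
    (hPT : ∀ (K : Type) [Field K] [NumberField K], poitouTate_selmerStructure_duality_conj K)
    (hF1 : Gross1991_heegnerPoint_sub_ratTorsion_mem_E0)
    (h372 : GrossLMS1991.prop37_2_frobeniusCongruence) :
    JetchevDivisibilityCarrierMult :=
  jetchevDivisibilityCarrierMult_of_namedPrintNoCV h52 (prop44_of_frobeniusCongruence h372) hPT
    (forall_hGZ_of_Gross1991 hF1)

/-- **K1 ⟸ four named Literature statements, NO reading binder** (carrier a prime `q ∣ N`, `q ≠ p`).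
[cite: Jetchev2008, Thm. 1.4, Thm. 5.2, Prop. 4.9, Prop. 5.3] [cite: McCallumLMS1991, Prop. 4.4, Prop. 5.2]
[cite: GrossLMS1991, Prop. 3.7, §6] [cite: GrossZagier1986, III (3.1)] -/
theorem jetchevDivisibilityCarrierNe_of_literatureNoCV
    (h52 : McCallum1991.prop52_exists_conductor_kolyvaginClass_order_eq)
    (hPT : ∀ (K : Type) [Field K] [NumberField K], poitouTate_selmerStructure_duality_conj K)
    (hF1 : Gross1991_heegnerPoint_sub_ratTorsion_mem_E0)
    (h372 : GrossLMS1991.prop37_2_frobeniusCongruence) :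
    JetchevDivisibilityCarrierNe :=
  jetchevDivisibilityCarrierNe_of_namedPrintNoCV h52 (prop44_of_frobeniusCongruence h372) hPT
    (forall_hGZ_of_Gross1991 hF1)

/-- **K4 ⟸ four named Literature statements, NO reading binder** (carrier `p`, `E` additive at `p`).
[cite: Jetchev2008, Thm. 1.4, Thm. 5.2, Prop. 4.9, Prop. 5.3] [cite: McCallumLMS1991, Prop. 4.4, Prop. 5.2]
[cite: GrossLMS1991, Prop. 3.7, §6] [cite: GrossZagier1986, III (3.1)] -/
theorem jetchevDivisibilityCarrierAdd_of_literatureNoCV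
    (h52 : McCallum1991.prop52_exists_conductor_kolyvaginClass_order_eq)
    (hPT : ∀ (K : Type) [Field K] [NumberField K], poitouTate_selmerStructure_duality_conj K)
    (hF1 : Gross1991_heegnerPoint_sub_ratTorsion_mem_E0)
    (h372 : GrossLMS1991.prop37_2_frobeniusCongruence) :
    JetchevDivisibilityCarrierAdd :=
  jetchevDivisibilityCarrierAdd_of_namedPrintNoCV h52 (prop44_of_frobeniusCongruence h372) hPT
    (forall_hGZ_of_Gross1991 hF1)

end Summit.BirchSwinnertonDyer.Rank1Residual.JET

end
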